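import Mathlib.Analysis.Calculus.Deriv.Add
import Mathlib.Analysis.Calculus.Deriv.Mul
import Mathlib.Analysis.Calculus.Deriv.Pow
import Literature.Barriers.CriticalPhenomena.WeaklySAWCouplingFlowProduct
import Literature.Barriers.CriticalPhenomena.WeaklySAWCouplingFlowCutoff
import HarnessLib

/-!
# [BBS-rg-flow, Lemma 2.1(iii)(a) with `γ = 2` and Lemma 2.3 for `ḡ`]: `∏(1 - 2β_lḡ_l)` and the
# derivative `ḡ_j' = ∂ḡ_j/∂ḡ₀ = (ḡ_j/ḡ₀)²(1 + O(ḡ₀))`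

Fifth file of the series formalising [BBS-rg-flow] (Bauerschmidt–Brydges–Slade, AHP 16 (2015),
arXiv:1211.2477) towards BBS 2015, Theorem 7.2.1 / Theorem 4.1 and
`Literature.Barriers.CriticalPhenomena.WeaklySAWFourDimLogCorrections`; continuation of
`WeaklySAWCouplingFlowCutoff.lean` (hypotheses `CutoffGbarHyp`: Assumption (A1) for an arbitrary
cut-off, exceptional scales, explicit smallness).

The products `∏_k (1 - 2β_kḡ_k)` are the propagators `A_j⋯A_l` of the `g`-component of the linearised
flow (Lemma 4.1(i) of the source) and, over `[0, j)`, the derivative `ḡ_j' = ∂ḡ_j/∂g₀` ((2.35)).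
Lemma 2.1(iii)(a) evaluates `∏_{k=j}^l (1 - γβ_kḡ_k)⁻¹ = (ḡ_j/ḡ_{l+1})^γ(c_j + O(χ_lḡ_l))`; for `γ = 2`
(the only value used downstream) the Taylor step (2.24) is the exact identity
`1 - 2x = (1-x)²(1 - x²/(1-x)²)`, and `(1 - β_kḡ_k) = ḡ_{k+1}/ḡ_k` telescopes. Proved here, with
explicit constants (`C_{2,0} = (1+N)/c + N + 2Ω/(Ω-1)` the constant of (2.3)):
* `gbarDeriv`, `hasDerivAt_gbar`, `continuous_gbar`: `ḡ_j` is differentiable in `g₀` with derivative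
  `ḡ_j' = ∏_{l<j}(1 - 2β_lḡ_l)`, `ḡ_{j+1}' = ḡ_j'(1 - 2β_jḡ_j)` ((2.35));
* `prod_one_sub_two_mul_le` / `_ge`: for every interval of scales,
  `(ḡ_{i+n}/ḡ_i)²(1 - 4B²C_{2,0}χ_iḡ_i) ≤ ∏_{l=i}^{i+n-1}(1 - 2β_lḡ_l) ≤ (ḡ_{i+n}/ḡ_i)²` — Lemma
  2.1(iii)(a) for `γ = 2` (upper bound with constant exactly `1`, which is Lemma 4.1(i)'s
  `A_j⋯A_l = O(g̊_{j+1}²/g̊_l²)`), using `r_k = O(β_kḡ_k)²` (`corr_mem`) and Σ_k χ_kḡ_k² ≤ C_{2,0}χ_iḡ_i;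
* `gbarDeriv_mem`, `gbarDeriv_pos`: (2.36) `ḡ_j' = (ḡ_j/ḡ₀)²(1 + O(ḡ₀))`, quantitatively
  `(ḡ_j/g₀)²(1 - 4B²C_{2,0}g₀) ≤ ḡ_j' ≤ (ḡ_j/g₀)²`, and `ḡ_j' > 0` for `8B²C_{2,0}g₀ ≤ 1`.

Deliberately NOT here: general real `γ ≥ 0` in (iii)(a) (the case `γ ∈ [0,1]`, `β ≥ 0` is
`WeaklySAWCouplingFlowProduct.lean`), the second derivative `ḡ_j''` and the derivatives of `z̄_j, μ̄_j`
(rest of Lemma 2.3), Lemma 2.1(iv).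

## References
* R. Bauerschmidt, D. C. Brydges, G. Slade, *Structural stability of a dynamical system near a
  non-hyperbolic fixed point*, Ann. Henri Poincaré 16 (2015), arXiv:1211.2477: Lemma 2.1(iii)(a)
  (2.6), (2.24)–(2.27); Lemma 2.3, (2.33), (2.35)–(2.36); Lemma 4.1(i). [BauerschmidtBrydgesSlade2015Flow]
-/

noncomputable section

open Filter Topology Set
open scoped BigOperators

namespace Literature.Barriers.CriticalPhenomena

namespace CTWSAW

/-! ## [BBS-rg-flow, Lemma 2.1(iii)(a) with `γ = 2` and Lemma 2.3 for `ḡ`]: the products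
`∏ (1 - 2β_lḡ_l)` and the derivative `ḡ_j' = ∂ḡ_j/∂g₀ = (ḡ_j/ḡ₀)²(1 + O(ḡ₀))` -/

/-- `∏_{l<j} (1 - 2β_lḡ_l)`, the derivative of `ḡ_j` with respect to the initial condition `g₀`
((2.35): `ḡ_{j+1}' = ḡ_j'(1 - 2β_jḡ_j)`, `ḡ₀' = 1`). [cite: BauerschmidtBrydgesSlade2015Flow, Lemma 2.3, (2.35)] -/
def gbarDeriv (β : ℕ → ℝ) (g₀ : ℝ) (j : ℕ) : ℝ := ∏ l ∈ Finset.range j, (1 - 2 * β l * gbar β g₀ l)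

/-- `ḡ₀' = 1`. [cite: BauerschmidtBrydgesSlade2015Flow, Lemma 2.3 (ḡ₀' = 1)] -/
@[simp] theorem gbarDeriv_zero (β : ℕ → ℝ) (g₀ : ℝ) : gbarDeriv β g₀ 0 = 1 := by simp [gbarDeriv]

/-- `ḡ_{j+1}' = ḡ_j'(1 - 2β_jḡ_j)`. [cite: BauerschmidtBrydgesSlade2015Flow, Lemma 2.3, (2.35)] -/
theorem gbarDeriv_succ (β : ℕ → ℝ) (g₀ : ℝ) (j : ℕ) :
    gbarDeriv β g₀ (j + 1) = gbarDeriv β g₀ j * (1 - 2 * β j * gbar β g₀ j) := by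
  simp [gbarDeriv, Finset.prod_range_succ]

/-- **`ḡ_j` is differentiable in `g₀` with derivative `∏_{l<j}(1 - 2β_lḡ_l)`** (everywhere, the
recursion being polynomial). [cite: BauerschmidtBrydgesSlade2015Flow, Lemma 2.3, (2.35)] -/
theorem hasDerivAt_gbar (β : ℕ → ℝ) (j : ℕ) (g₀ : ℝ) :
    HasDerivAt (fun g => gbar β g j) (gbarDeriv β g₀ j) g₀ := by
  induction j with
  | zero => simpa using hasDerivAt_id' g₀
  | succ j ih =>
    have h2 : HasDerivAt (fun g => β j * (gbar β g j * gbar β g j))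
        (β j * (gbarDeriv β g₀ j * gbar β g₀ j + gbar β g₀ j * gbarDeriv β g₀ j)) g₀ :=
      HasDerivAt.const_mul (β j) (HasDerivAt.mul ih ih)
    have h3 : HasDerivAt (fun g => gbar β g j - β j * (gbar β g j * gbar β g j))
        (gbarDeriv β g₀ j - β j * (gbarDeriv β g₀ j * gbar β g₀ j + gbar β g₀ j * gbarDeriv β g₀ j)) g₀ :=
      HasDerivAt.sub ih h2
    have hfun : (fun g => gbar β g (j + 1)) = fun g => gbar β g j - β j * (gbar β g j * gbar β g j) := by
      funext g; rw [gbar_succ]; ring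
    have hd : gbarDeriv β g₀ j * (1 - 2 * β j * gbar β g₀ j) =
        gbarDeriv β g₀ j - β j * (gbarDeriv β g₀ j * gbar β g₀ j + gbar β g₀ j * gbarDeriv β g₀ j) := by
      ring
    rw [hfun, gbarDeriv_succ, hd]
    exact h3

/-- `ḡ_j` is continuous in `g₀`. [cite: BauerschmidtBrydgesSlade2015Flow, Lemma 2.2 ("ḡ_j is defined by a finite recursion")] -/
theorem continuous_gbar (β : ℕ → ℝ) (j : ℕ) : Continuous fun g => gbar β g j :=
  continuous_iff_continuousAt.2 fun g => (hasDerivAt_gbar β j g).continuousAt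

/-- The algebra behind (2.24) with `γ = 2`: `1 - 2x = (1 - x)²(1 - q)`, `q = x²/(1-x)²`.
[cite: BauerschmidtBrydgesSlade2015Flow, Lemma 2.1(iii)(a), (2.24) (Taylor: (1-γβḡ)⁻¹ = (1-βḡ)^{-γ}(1+r))] -/
theorem one_sub_two_mul_eq {x : ℝ} (hx : x ≠ 1) :
    1 - 2 * x = (1 - x) ^ 2 * (1 - x ^ 2 / (1 - x) ^ 2) := by
  have : (1 - x) ≠ 0 := sub_ne_zero.2 (Ne.symm hx)
  field_simp
  ring

namespace CutoffGbarHyp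

variable {β : ℕ → ℝ} {Ω : ℝ} {k : ℕ∞} {B c : ℝ} {N : ℕ} {g₀ : ℝ} (h : CutoffGbarHyp β Ω k B c N g₀)
include h

/-- The correction `q_l = (β_lḡ_l)²/(1 - β_lḡ_l)²` satisfies `0 ≤ q_l ≤ 4β_l²ḡ_l² ≤ 4B² Ω^{-(l-k)₊}ḡ_l²`
("`r_k = O(β_kḡ_k)²`"). [cite: BauerschmidtBrydgesSlade2015Flow, Lemma 2.1(iii)(a) (r_k = O(β_kḡ_k)²)] -/
theorem corr_mem (l : ℕ) :
    (β l * gbar β g₀ l) ^ 2 / (1 - β l * gbar β g₀ l) ^ 2 ∈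
      Set.Icc (0 : ℝ) (4 * B ^ 2 * (cutoffWeight Ω k l * gbar β g₀ l ^ 2)) := by
  obtain ⟨h1, h2⟩ := h.one_sub_mem l
  have hw1 := h.weight_le_one l; have hw0 := (h.weight_pos l).le
  have hg := (h.gbar_pos l).le
  refine ⟨by positivity, ?_⟩
  rw [div_le_iff₀ (by positivity)]
  have hβ : |β l| ≤ B * cutoffWeight Ω k l := h.abs_le l
  have hβ2 : (β l) ^ 2 ≤ (B * cutoffWeight Ω k l) ^ 2 := by
    calc (β l) ^ 2 = |β l| ^ 2 := (sq_abs _).symm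
      _ ≤ (B * cutoffWeight Ω k l) ^ 2 := pow_le_pow_left₀ (abs_nonneg _) hβ 2
  have hww : cutoffWeight Ω k l ^ 2 ≤ cutoffWeight Ω k l := by nlinarith
  have hB := h.B_nonneg
  calc (β l * gbar β g₀ l) ^ 2 = β l ^ 2 * gbar β g₀ l ^ 2 := by ring
    _ ≤ (B * cutoffWeight Ω k l) ^ 2 * gbar β g₀ l ^ 2 := mul_le_mul_of_nonneg_right hβ2 (sq_nonneg _)
    _ = B ^ 2 * cutoffWeight Ω k l ^ 2 * gbar β g₀ l ^ 2 := by ring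
    _ ≤ B ^ 2 * cutoffWeight Ω k l * gbar β g₀ l ^ 2 := by gcongr
    _ ≤ 4 * B ^ 2 * (cutoffWeight Ω k l * gbar β g₀ l ^ 2) * (1 - β l * gbar β g₀ l) ^ 2 := by
        have hA : 0 ≤ B ^ 2 * cutoffWeight Ω k l * gbar β g₀ l ^ 2 := by positivity
        have hsq : 1 / 4 ≤ (1 - β l * gbar β g₀ l) ^ 2 := by nlinarith
        nlinarith

/-- **[BBS-rg-flow, Lemma 2.1(iii)(a) with `γ = 2`, upper bound]**: for any interval of scales
`[i, i+n)`, `∏_{l=i}^{i+n-1} (1 - 2β_lḡ_l) ≤ (ḡ_{i+n}/ḡ_i)²` — with constant exactly `1`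
(`1 - 2x ≤ (1-x)²`); this is the bound `A_j⋯A_l = O(g̊_{j+1}²/g̊_l²)` of Lemma 4.1(i).
[cite: BauerschmidtBrydgesSlade2015Flow, Lemma 2.1(iii)(a), (2.6), and Lemma 4.1(i), (4.6)] -/
theorem prod_one_sub_two_mul_le (i n : ℕ) :
    ∏ l ∈ Finset.range n, (1 - 2 * β (i + l) * gbar β g₀ (i + l)) ≤
      (gbar β g₀ (i + n) / gbar β g₀ i) ^ 2 := by
  have key : ∀ n, (gbar β g₀ (i + n) / gbar β g₀ i) ^ 2 =
      ∏ l ∈ Finset.range n, (1 - β (i + l) * gbar β g₀ (i + l)) ^ 2 := by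
    intro n
    rw [Finset.prod_pow, gbar_add_eq_mul_prod, mul_div_cancel_left₀ _ (h.gbar_pos i).ne']
  rw [key]
  refine Finset.prod_le_prod (fun l _ => ?_) fun l _ => ?_
  · have := h.abs_beta_mul_gbar_le_half (i + l)
    have hg := (h.gbar_pos (i + l)).le
    have : |β (i + l) * gbar β g₀ (i + l)| ≤ 1 / 2 := by rwa [abs_mul, abs_of_nonneg hg]
    linarith [le_abs_self (β (i + l) * gbar β g₀ (i + l))]
  · nlinarith [sq_nonneg (β (i + l) * gbar β g₀ (i + l))]

/-- **[BBS-rg-flow, Lemma 2.1(iii)(a) with `γ = 2`, two-sided]**: `∏_{l=i}^{i+n-1}(1 - 2β_lḡ_l) =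
(ḡ_{i+n}/ḡ_i)² ∏(1 - q_l)` with `1 - 4B²C_{2,0}Ω^{-(i-k)₊}ḡ_i ≤ ∏_{l}(1 - q_l) ≤ 1`, i.e. the printed
`(ḡ_j/ḡ_{l+1})^γ(c_j + O(χ_lḡ_l))`, `c_j = 1 + O(χ_jḡ_j)`, for `γ = 2` with explicit constants.
[cite: BauerschmidtBrydgesSlade2015Flow, Lemma 2.1(iii)(a), (2.6) and (2.24)–(2.27)] -/
theorem prod_one_sub_two_mul_ge (i n : ℕ) :
    (gbar β g₀ (i + n) / gbar β g₀ i) ^ 2 *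
        (1 - 4 * B ^ 2 * ((1 + N) / c + N + 2 * Ω / (Ω - 1)) * (cutoffWeight Ω k i * gbar β g₀ i)) ≤
      ∏ l ∈ Finset.range n, (1 - 2 * β (i + l) * gbar β g₀ (i + l)) := by
  set q : ℕ → ℝ := fun l => (β (i + l) * gbar β g₀ (i + l)) ^ 2 / (1 - β (i + l) * gbar β g₀ (i + l)) ^ 2
    with hq
  have hfac : ∀ l, 1 - 2 * β (i + l) * gbar β g₀ (i + l) =
      (1 - β (i + l) * gbar β g₀ (i + l)) ^ 2 * (1 - q l) := fun l => by
    have hne : β (i + l) * gbar β g₀ (i + l) ≠ 1 := by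
      have := (h.one_sub_mem (i + l)).1; intro hh; rw [hh] at this; norm_num at this
    simp only [hq]
    rw [show 2 * β (i + l) * gbar β g₀ (i + l) = 2 * (β (i + l) * gbar β g₀ (i + l)) by ring]
    exact one_sub_two_mul_eq hne
  have key : ∏ l ∈ Finset.range n, (1 - 2 * β (i + l) * gbar β g₀ (i + l)) =
      (gbar β g₀ (i + n) / gbar β g₀ i) ^ 2 * ∏ l ∈ Finset.range n, (1 - q l) := by
    rw [Finset.prod_congr rfl fun l _ => hfac l, Finset.prod_mul_distrib, Finset.prod_pow,
      gbar_add_eq_mul_prod, mul_div_cancel_left₀ _ (h.gbar_pos i).ne']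
  rw [key]
  refine mul_le_mul_of_nonneg_left ?_ (sq_nonneg _)
  -- `1 - Σ q_l ≤ ∏ (1 - q_l)` and `Σ_{l<n} q_l ≤ 4B² C_{2,0} w_i ḡ_i`
  have hq0 : ∀ l, 0 ≤ q l := fun l => (h.corr_mem (i + l)).1
  have hq1 : ∀ l, q l ≤ 1 := fun l => by
    have := (h.corr_mem (i + l)).2
    have hw := h.weight_le_one (i + l); have hg := h.gbar_le_half (i + l)
    have hw0 := (h.weight_pos (i + l)).le; have hg0 := (h.gbar_pos (i + l)).le
    have hB := h.B_nonneg
    -- `4B² w ḡ² ≤ 4B² · ḡ · (1/2) ≤ …`; use `Bḡ ≤ 1/4`-type smallness: `B ḡ ≤ B · 2g₀ ≤ 1/2`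
    have hBg : B * gbar β g₀ (i + l) ≤ 1 / 2 := by
      have := h.gbar_le_two_mul_init (i + l); nlinarith [h.smallB]
    calc q l ≤ 4 * B ^ 2 * (cutoffWeight Ω k (i + l) * gbar β g₀ (i + l) ^ 2) := this
      _ ≤ 4 * B ^ 2 * (1 * gbar β g₀ (i + l) ^ 2) := by gcongr
      _ = 4 * (B * gbar β g₀ (i + l)) ^ 2 := by ring
      _ ≤ 4 * (1 / 2) ^ 2 := by gcongr
      _ = 1 := by norm_num
  have hsum : ∑ l ∈ Finset.range n, q l ≤
      4 * B ^ 2 * ((1 + N) / c + N + 2 * Ω / (Ω - 1)) * (cutoffWeight Ω k i * gbar β g₀ i) := by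
    calc ∑ l ∈ Finset.range n, q l
        ≤ ∑ l ∈ Finset.range n, 4 * B ^ 2 * (cutoffWeight Ω k (l + i) * gbar β g₀ (l + i) ^ 2) :=
          Finset.sum_le_sum fun l _ => by rw [add_comm l i]; exact (h.corr_mem (i + l)).2
      _ = 4 * B ^ 2 * ∑ l ∈ Finset.range n, cutoffWeight Ω k (l + i) * gbar β g₀ (l + i) ^ 2 := by
          rw [Finset.mul_sum]
      _ ≤ 4 * B ^ 2 * (((1 + N) / c + N + 2 * Ω / (Ω - 1)) * (cutoffWeight Ω k i * gbar β g₀ i)) := by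
          refine mul_le_mul_of_nonneg_left ?_ (by positivity)
          obtain ⟨hs, ht⟩ := h.summable_weight_mul_gbar_sq i
          exact (hs.sum_le_tsum (Finset.range n) fun l _ =>
            mul_nonneg (h.weight_pos _).le (sq_nonneg _)).trans ht
      _ = _ := by ring
  calc 1 - 4 * B ^ 2 * ((1 + N) / c + N + 2 * Ω / (Ω - 1)) * (cutoffWeight Ω k i * gbar β g₀ i)
      ≤ 1 - ∑ l ∈ Finset.range n, q l := by linarith
    _ ≤ ∏ l ∈ Finset.range n, (1 - q l) := by
        have := one_sub_sum_range_le_prod (fun l => 1 - q l) n (fun l _ => by linarith [hq1 l])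
          (fun l _ => by linarith [hq0 l])
        simpa only [sub_sub_cancel] using this

/-- **[BBS-rg-flow, Lemma 2.3, (2.36)]**: `ḡ_j' = (ḡ_j/ḡ₀)²(1 + O(ḡ₀))`, quantitatively
`(ḡ_j/g₀)²(1 - 4B²C_{2,0}g₀) ≤ ḡ_j' ≤ (ḡ_j/g₀)²`.
[cite: BauerschmidtBrydgesSlade2015Flow, Lemma 2.3, (2.33) and (2.36)] -/
theorem gbarDeriv_mem (j : ℕ) :
    gbarDeriv β g₀ j ∈ Set.Icc
      ((gbar β g₀ j / g₀) ^ 2 * (1 - 4 * B ^ 2 * ((1 + N) / c + N + 2 * Ω / (Ω - 1)) * g₀))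
      ((gbar β g₀ j / g₀) ^ 2) := by
  have h1 := h.prod_one_sub_two_mul_le 0 j
  have h2 := h.prod_one_sub_two_mul_ge 0 j
  simp only [zero_add, gbar_zero] at h1 h2
  have hw0 : cutoffWeight Ω k 0 ≤ 1 := h.weight_le_one 0
  refine ⟨le_trans ?_ h2, h1⟩
  refine mul_le_mul_of_nonneg_left ?_ (sq_nonneg _)
  have hC := h.C20_nonneg; have hB := h.B_nonneg; have hg := h.g₀_pos
  have : cutoffWeight Ω k 0 * g₀ ≤ g₀ := mul_le_of_le_one_left hg.le hw0
  nlinarith [mul_nonneg (mul_nonneg (by positivity : (0:ℝ) ≤ 4 * B ^ 2) hC) (sub_nonneg.2 this)]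

/-- `0 < ḡ_j'` under the smallness `8B²C_{2,0}g₀ ≤ 1` (so `ḡ_j` is increasing in `g₀`).
[cite: BauerschmidtBrydgesSlade2015Flow, Lemma 2.3, (2.33)] -/
theorem gbarDeriv_pos (hsmall : 8 * B ^ 2 * ((1 + N) / c + N + 2 * Ω / (Ω - 1)) * g₀ ≤ 1) (j : ℕ) :
    0 < gbarDeriv β g₀ j := by
  obtain ⟨h1, -⟩ := h.gbarDeriv_mem j
  refine lt_of_lt_of_le (mul_pos (pow_pos (div_pos (h.gbar_pos j) h.g₀_pos) 2) ?_) h1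
  have hC := h.C20_nonneg; have hB := h.B_nonneg; have hg := h.g₀_pos
  nlinarith

end CutoffGbarHyp


end CTWSAW

end Literature.Barriers.CriticalPhenomena
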